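import Mathlib
import HarnessLib
import Summits.HubbardSuperconductivity.HubbardSuperconductivity.Theorems.KLProgrammeC4aPartnerBandCooperDefectTwo
import Summits.HubbardSuperconductivity.HubbardSuperconductivity.Theorems.KLProgrammeC4aPartnerBandCritical

/-!
# Route `KLProgramme` — crux C4a, S3 brick (B2, ORDER 3): the third t-derivative of the partner band of the co-moving bubble loop near Cooper (pp) and near
# forward (ph) is `O(|ρ| + |ϑ − π|)` resp. `O(|ρ| + |ϑ|)`, uniformly in the loop variables

Cell `gate-hubbard-kl`, lane hubbard-kl-c4a-1 (g6); helper for stub (C) `stub_twoLeg_curvature` of the engine-flow child `KLRegimeEngineV17F2`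
(stmt-HubbardSuperconductivity-20437); memo HOME/hubbard-kl-c4a-1/C4A-PLAN.md §24.4 (i), §24.6 (B2).  Sequel to `…C4aPartnerBandCooperDefect` (orders 0, 1),
`…CooperDefectTwo` (order 2) and `…ForwardDefect` (ph twin).  With `ē(t) = f(S(t) − γ(t))`, reference `f(−γ(t)) ≡ e`:

* §1 `abs_apply₃_le`, `abs_bilin_add_add_sub_le`, `abs_trilin_add_sub_le` — operator-norm bookkeeping for bi- and trilinear forms;
  **`abs_iteratedDeriv_three_comp_sub_le`** — the carrier-free ORDER-3 lemma: with `‖Df‖ ≤ K₁`, …, `‖D⁴f‖ ≤ K₄` and sizes `‖S^{(j)}(0)‖ ≤ s_j` (`j ≤ 3`),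
  `‖γ^{(j)}(0)‖ ≤ m_j` (`1 ≤ j ≤ 3`):
  `|∂_t³|₀ f(S − γ)| ≤ K₃(s₁³ + 3s₁²m₁ + 3s₁m₁²) + 3K₂(s₁s₂ + s₂m₁ + s₁m₂) + K₁s₃ + K₄s₀m₁³ + 3K₃s₀m₁m₂ + K₂s₀m₃` — every monomial carries an `s_j`
  (third-order chain rule `…PerturbedFermiCurveCompChain.iteratedDeriv_three_comp_eq` on both composites, the reference one vanishing; multilinear expansion;
  Lipschitz bounds of `Df`, `D²f`, `D³f` from `K₂`, `K₃`, `K₄`);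
* §2 **`abs_iteratedDeriv_three_partnerBand_pp_le`** / **`abs_iteratedDeriv_three_partnerBand_ph_le`** — the instantiations at the pp loop `S = pairSumPath μ K ρ ϑ θ`
  (partner `S(t) − Φ(e,α+t)`) and at the ph loop (partner `Φ(e,α+t) − D(t)`, `D = pairDiffPath μ K ρ ϑ θ`, read as `S̃ − γ̃` with `S̃ = −D`, `γ̃ = −Φ(e,α+·)`),
  with the path sizes `s₀ … s₃` kept as hypotheses — they are supplied, each `O(|ρ| + |ϑ∓π|)`, by g5's rigidity: `norm_pairSumPath_zero_le`, `norm_deriv_pairSumPath_le_rigid`,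
  `norm_iteratedDeriv_pairSumPath_le_rigid (i := 2, 3)` with `norm_iteratedDeriv_two/three_levelPoint_sub_le` (and the `pairDiffPath` twins), while `m_j = msD A₃ A₄ j`
  (`norm_iteratedDeriv_levelPoint_le`).

Pure calculus; nothing about the model's sizes; nothing asserts superconductivity.  References: FST II CPAM 51 (1998) §3 Thm 3.5; BGM 2006 §2.4 (2.40) [cite: BenfattoGiulianiMastropietro2006].
-/

noncomputable section

namespace Summit.HubbardSuperconductivity.HubbardSuperconductivity.Theorems.C4a

set_option linter.dupNamespace false -- summit = problem name (single-conjunct summit), D-0017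
set_option maxSynthPendingDepth 3 -- nested operator-norm instances (third Fréchet derivatives)

open Real Set Filter
open scoped Topology
open Literature.MathematicalPhysics.QuantumLattice Literature.MathematicalPhysics.QuantumLattice.BandSectorCounting Literature.Probability.LatticeModels
open Summit.HubbardSuperconductivity.HubbardSuperconductivity.Theorems.KLRegimeSplit
open Summit.HubbardSuperconductivity.HubbardSuperconductivity.Theorems.DispersionFlow
open Summit.HubbardSuperconductivity.HubbardSuperconductivity.Theorems.PerturbedFermiCurve

/-! ## §1 The carrier-free third-order lemma -/

section Abstract

variable {V : Type*} [NormedAddCommGroup V] [NormedSpace ℝ V]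

/-- `|T u v w| ≤ ‖T‖·‖u‖·‖v‖·‖w‖` for a continuous trilinear form. [folklore] -/
theorem abs_apply₃_le (T : V →L[ℝ] V →L[ℝ] V →L[ℝ] ℝ) (u v w : V) : |T u v w| ≤ ‖T‖ * ‖u‖ * ‖v‖ * ‖w‖ := by
  rw [← Real.norm_eq_abs]
  exact ((T u v).le_opNorm w).trans (mul_le_mul_of_nonneg_right (T.le_opNorm₂ u v) (norm_nonneg _))

/-- Bilinear expansion against a reference: `|B(u+v, u′+v′) − B(v, v′)| ≤ ‖B‖(‖u‖‖u′‖ + ‖u‖‖v′‖ + ‖v‖‖u′‖)`. [folklore] -/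
theorem abs_bilin_add_add_sub_le (B : V →L[ℝ] V →L[ℝ] ℝ) (u v u' v' : V) :
    |B (u + v) (u' + v') - B v v'| ≤ ‖B‖ * (‖u‖ * ‖u'‖ + ‖u‖ * ‖v'‖ + ‖v‖ * ‖u'‖) := by
  have h : B (u + v) (u' + v') - B v v' = B u u' + B u v' + B v u' := by
    simp only [map_add, show ∀ (P Q : V →L[ℝ] ℝ) (z : V), (P + Q) z = P z + Q z from fun _ _ _ => rfl]; ring
  rw [h]
  have h1 := B.le_opNorm₂ u u'
  have h2 := B.le_opNorm₂ u v'
  have h3 := B.le_opNorm₂ v u'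
  rw [Real.norm_eq_abs] at h1 h2 h3
  calc |B u u' + B u v' + B v u'| ≤ |B u u'| + |B u v'| + |B v u'| := abs_add_three _ _ _
    _ ≤ ‖B‖ * ‖u‖ * ‖u'‖ + ‖B‖ * ‖u‖ * ‖v'‖ + ‖B‖ * ‖v‖ * ‖u'‖ := add_le_add_three h1 h2 h3
    _ = ‖B‖ * (‖u‖ * ‖u'‖ + ‖u‖ * ‖v'‖ + ‖v‖ * ‖u'‖) := by ring

/-- Trilinear (diagonal) expansion against a reference: `|T(u+v)³ − T(v)³| ≤ ‖T‖(‖u‖³ + 3‖u‖²‖v‖ + 3‖u‖‖v‖²)`. [folklore] -/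
theorem abs_trilin_add_sub_le (T : V →L[ℝ] V →L[ℝ] V →L[ℝ] ℝ) (u v : V) :
    |T (u + v) (u + v) (u + v) - T v v v| ≤ ‖T‖ * (‖u‖ ^ 3 + 3 * ‖u‖ ^ 2 * ‖v‖ + 3 * ‖u‖ * ‖v‖ ^ 2) := by
  have h : T (u + v) (u + v) (u + v) - T v v v = T u u u + T u u v + T u v u + (T u v v + T v u u + T v u v) + T v v u := by
    simp only [map_add, show ∀ (P Q : V →L[ℝ] ℝ) (z : V), (P + Q) z = P z + Q z from fun _ _ _ => rfl,
      show ∀ (P Q : V →L[ℝ] V →L[ℝ] ℝ) (z : V), (P + Q) z = P z + Q z from fun _ _ _ => rfl]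
    ring
  rw [h]
  have t1 := abs_apply₃_le T u u u
  have t2 := abs_apply₃_le T u u v
  have t3 := abs_apply₃_le T u v u
  have t4 := abs_apply₃_le T u v v
  have t5 := abs_apply₃_le T v u u
  have t6 := abs_apply₃_le T v u v
  have t7 := abs_apply₃_le T v v u
  have tri₁ := abs_add_three (T u u u) (T u u v) (T u v u)
  have tri₂ := abs_add_three (T u v v) (T v u u) (T v u v)
  have tri₃ := abs_add_three (T u u u + T u u v + T u v u) (T u v v + T v u u + T v u v) (T v v u)
  linarith

/-- **Third t-derivative of `f(S(t) − γ(t))` against the rigid reference `f(−γ(t)) ≡ e`**: every monomial of the bound carries a size `s_j` of `S`. -/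
theorem abs_iteratedDeriv_three_comp_sub_le {f : V → ℝ} (hf : ContDiff ℝ 4 f) {K₁ K₂ K₃ K₄ : ℝ} (hK₁ : ∀ x, ‖fderiv ℝ f x‖ ≤ K₁)
    (hK₂ : ∀ x, ‖iteratedFDeriv ℝ 2 f x‖ ≤ K₂) (hK₃ : ∀ x, ‖iteratedFDeriv ℝ 3 f x‖ ≤ K₃) (hK₄ : ∀ x, ‖iteratedFDeriv ℝ 4 f x‖ ≤ K₄) {S γ : ℝ → V}
    (hS : ContDiff ℝ 4 S) (hγ : ContDiff ℝ 4 γ) {e : ℝ} (href : ∀ t, f (-γ t) = e) {s₀ s₁ s₂ s₃ m₁ m₂ m₃ : ℝ} (hs₀ : ‖S 0‖ ≤ s₀)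
    (hs₁ : ‖iteratedDeriv 1 S 0‖ ≤ s₁) (hs₂ : ‖iteratedDeriv 2 S 0‖ ≤ s₂) (hs₃ : ‖iteratedDeriv 3 S 0‖ ≤ s₃) (hm₁ : ‖iteratedDeriv 1 γ 0‖ ≤ m₁)
    (hm₂ : ‖iteratedDeriv 2 γ 0‖ ≤ m₂) (hm₃ : ‖iteratedDeriv 3 γ 0‖ ≤ m₃) :
    |iteratedDeriv 3 (fun t : ℝ => f (S t - γ t)) 0| ≤
      K₃ * (s₁ ^ 3 + 3 * s₁ ^ 2 * m₁ + 3 * s₁ * m₁ ^ 2) + 3 * K₂ * (s₁ * s₂ + s₂ * m₁ + s₁ * m₂) + K₁ * s₃ + K₄ * s₀ * m₁ ^ 3 +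
        3 * K₃ * s₀ * m₁ * m₂ + K₂ * s₀ * m₃ := by
  have hK₁0 : 0 ≤ K₁ := (norm_nonneg _).trans (hK₁ 0)
  have hK₂0 : 0 ≤ K₂ := (norm_nonneg _).trans (hK₂ 0)
  have hK₃0 : 0 ≤ K₃ := (norm_nonneg _).trans (hK₃ 0)
  have hK₄0 : 0 ≤ K₄ := (norm_nonneg _).trans (hK₄ 0)
  have hs00 : 0 ≤ s₀ := (norm_nonneg _).trans hs₀
  have hs10 : 0 ≤ s₁ := (norm_nonneg _).trans hs₁
  have hs20 : 0 ≤ s₂ := (norm_nonneg _).trans hs₂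
  have hm10 : 0 ≤ m₁ := (norm_nonneg _).trans hm₁
  have hm20 : 0 ≤ m₂ := (norm_nonneg _).trans hm₂
  have hm30 : 0 ≤ m₃ := (norm_nonneg _).trans hm₃
  -- the two composites and their third derivatives
  have hc : ContDiff ℝ 4 (fun t : ℝ => S t - γ t) := hS.sub hγ
  have hn : ContDiff ℝ 4 (fun t : ℝ => -γ t) := hγ.neg
  have h1 := iteratedDeriv_three_comp_eq hf hc 0
  have h2 := iteratedDeriv_three_comp_eq hf hn 0
  have hc1 : iteratedDeriv 1 (fun t : ℝ => S t - γ t) 0 = iteratedDeriv 1 S 0 - iteratedDeriv 1 γ 0 :=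
    iteratedDeriv_fun_sub (hS.contDiffAt.of_le (by norm_num)) (hγ.contDiffAt.of_le (by norm_num))
  have hc2 : iteratedDeriv 2 (fun t : ℝ => S t - γ t) 0 = iteratedDeriv 2 S 0 - iteratedDeriv 2 γ 0 :=
    iteratedDeriv_fun_sub (hS.contDiffAt.of_le (by norm_num)) (hγ.contDiffAt.of_le (by norm_num))
  have hc3 : iteratedDeriv 3 (fun t : ℝ => S t - γ t) 0 = iteratedDeriv 3 S 0 - iteratedDeriv 3 γ 0 :=
    iteratedDeriv_fun_sub (hS.contDiffAt.of_le (by norm_num)) (hγ.contDiffAt.of_le (by norm_num))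
  have hn1 : iteratedDeriv 1 (fun t : ℝ => -γ t) 0 = -iteratedDeriv 1 γ 0 := iteratedDeriv_fun_neg 1 γ 0
  have hn2 : iteratedDeriv 2 (fun t : ℝ => -γ t) 0 = -iteratedDeriv 2 γ 0 := iteratedDeriv_fun_neg 2 γ 0
  have hn3 : iteratedDeriv 3 (fun t : ℝ => -γ t) 0 = -iteratedDeriv 3 γ 0 := iteratedDeriv_fun_neg 3 γ 0
  -- the reference composite is constant, so its third derivative vanishes
  have href3 : iteratedDeriv 3 (f ∘ fun t : ℝ => -γ t) 0 = 0 := by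
    rw [show (f ∘ fun t : ℝ => -γ t) = fun _ => e from funext fun t => href t, iteratedDeriv_const]; simp
  rw [h2, hn1, hn2, hn3] at href3
  -- abbreviations
  set L₃ := fderiv ℝ (fderiv ℝ (fderiv ℝ f)) with hL₃
  set L₂ := fderiv ℝ (fderiv ℝ f) with hL₂
  set x := S 0 - γ 0 with hx
  set y := -γ 0 with hy
  set a₁ := iteratedDeriv 1 S 0
  set a₂ := iteratedDeriv 2 S 0
  set a₃ := iteratedDeriv 3 S 0
  set b₁ := iteratedDeriv 1 γ 0
  set b₂ := iteratedDeriv 2 γ 0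
  set b₃ := iteratedDeriv 3 γ 0
  have hxy : x - y = S 0 := by rw [hx, hy]; abel
  have hnb₁ : ‖-b₁‖ ≤ m₁ := by rw [norm_neg]; exact hm₁
  have hnb₂ : ‖-b₂‖ ≤ m₂ := by rw [norm_neg]; exact hm₂
  have hnb₃ : ‖-b₃‖ ≤ m₃ := by rw [norm_neg]; exact hm₃
  -- rewrite the target and regroup against the (vanishing) reference expression
  have hfun : (fun t : ℝ => f (S t - γ t)) = f ∘ fun t : ℝ => S t - γ t := rfl
  rw [hfun, h1, hc1, hc2, hc3]
  have key : L₃ x (a₁ - b₁) (a₁ - b₁) (a₁ - b₁) + L₂ x (a₂ - b₂) (a₁ - b₁) + L₂ x (a₁ - b₁) (a₂ - b₂) +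
        (L₂ x (a₁ - b₁) (a₂ - b₂) + fderiv ℝ f x (a₃ - b₃)) =
      (L₃ x (a₁ - b₁) (a₁ - b₁) (a₁ - b₁) - L₃ y (-b₁) (-b₁) (-b₁)) + (L₂ x (a₂ - b₂) (a₁ - b₁) - L₂ y (-b₂) (-b₁)) +
          2 * (L₂ x (a₁ - b₁) (a₂ - b₂) - L₂ y (-b₁) (-b₂)) + (fderiv ℝ f x (a₃ - b₃) - fderiv ℝ f y (-b₃)) +
        (L₃ y (-b₁) (-b₁) (-b₁) + L₂ y (-b₂) (-b₁) + L₂ y (-b₁) (-b₂) + (L₂ y (-b₁) (-b₂) + fderiv ℝ f y (-b₃))) := by ring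
  rw [key, href3, add_zero]
  -- norms and Lipschitz bounds of the operators
  have hL₃x : ‖L₃ x‖ ≤ K₃ := by rw [hL₃, norm_fderiv_three_eq_norm_iteratedFDeriv]; exact hK₃ x
  have hL₂x : ‖L₂ x‖ ≤ K₂ := by rw [hL₂, norm_fderiv_two_eq_norm_iteratedFDeriv]; exact hK₂ x
  have hLip₃ : ‖L₃ x - L₃ y‖ ≤ K₄ * ‖S 0‖ := by
    have hdiff : Differentiable ℝ (fderiv ℝ (fderiv ℝ (fderiv ℝ f))) :=
      (((hf.fderiv_right (m := 3) (by norm_num)).fderiv_right (m := 2) (by norm_num)).fderiv_right (m := 1) (by norm_num)).differentiable one_ne_zero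
    have h := (convex_univ (𝕜 := ℝ) (E := V)).norm_image_sub_le_of_norm_fderiv_le (𝕜 := ℝ) (f := fderiv ℝ (fderiv ℝ (fderiv ℝ f))) (fun z _ => hdiff z)
      (fun z _ => by rw [norm_fderiv_four_eq_norm_iteratedFDeriv]; exact hK₄ z) (mem_univ y) (mem_univ x)
    rwa [hxy] at h
  have hLip₂ : ‖L₂ x - L₂ y‖ ≤ K₃ * ‖S 0‖ := by
    have hdiff : Differentiable ℝ (fderiv ℝ (fderiv ℝ f)) := ((hf.fderiv_right (m := 3) (by norm_num)).fderiv_right (m := 2) (by norm_num)).differentiable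
      (by norm_num)
    have h := (convex_univ (𝕜 := ℝ) (E := V)).norm_image_sub_le_of_norm_fderiv_le (𝕜 := ℝ) (f := fderiv ℝ (fderiv ℝ f)) (fun z _ => hdiff z)
      (fun z _ => by rw [norm_fderiv_three_eq_norm_iteratedFDeriv]; exact hK₃ z) (mem_univ y) (mem_univ x)
    rwa [hxy] at h
  have hLip₁ : ‖fderiv ℝ f x - fderiv ℝ f y‖ ≤ K₂ * ‖S 0‖ := by
    have hdiff : Differentiable ℝ (fderiv ℝ f) := (hf.fderiv_right (m := 3) (by norm_num)).differentiable (by norm_num)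
    have h := (convex_univ (𝕜 := ℝ) (E := V)).norm_image_sub_le_of_norm_fderiv_le (𝕜 := ℝ) (f := fderiv ℝ f) (fun z _ => hdiff z)
      (fun z _ => by rw [norm_fderiv_two_eq_norm_iteratedFDeriv]; exact hK₂ z) (mem_univ y) (mem_univ x)
    rwa [hxy] at h
  -- group 1: the trilinear term
  have g1 : |L₃ x (a₁ - b₁) (a₁ - b₁) (a₁ - b₁) - L₃ y (-b₁) (-b₁) (-b₁)| ≤
      K₃ * (s₁ ^ 3 + 3 * s₁ ^ 2 * m₁ + 3 * s₁ * m₁ ^ 2) + K₄ * s₀ * m₁ ^ 3 := by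
    have e₁ : |L₃ x (a₁ - b₁) (a₁ - b₁) (a₁ - b₁) - L₃ x (-b₁) (-b₁) (-b₁)| ≤ K₃ * (s₁ ^ 3 + 3 * s₁ ^ 2 * m₁ + 3 * s₁ * m₁ ^ 2) := by
      rw [sub_eq_add_neg a₁ b₁]
      refine (abs_trilin_add_sub_le (L₃ x) a₁ (-b₁)).trans ?_
      have : ‖a₁‖ ^ 3 + 3 * ‖a₁‖ ^ 2 * ‖-b₁‖ + 3 * ‖a₁‖ * ‖-b₁‖ ^ 2 ≤ s₁ ^ 3 + 3 * s₁ ^ 2 * m₁ + 3 * s₁ * m₁ ^ 2 := by gcongr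
      exact mul_le_mul hL₃x this (by positivity) hK₃0
    have e₂ : |L₃ x (-b₁) (-b₁) (-b₁) - L₃ y (-b₁) (-b₁) (-b₁)| ≤ K₄ * s₀ * m₁ ^ 3 := by
      rw [show L₃ x (-b₁) (-b₁) (-b₁) - L₃ y (-b₁) (-b₁) (-b₁) = (L₃ x - L₃ y) (-b₁) (-b₁) (-b₁) from rfl]
      refine (abs_apply₃_le _ _ _ _).trans ?_
      have hP : ‖L₃ x - L₃ y‖ ≤ K₄ * s₀ := hLip₃.trans (mul_le_mul_of_nonneg_left hs₀ hK₄0)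
      have hP0 : 0 ≤ K₄ * s₀ := mul_nonneg hK₄0 hs00
      calc ‖L₃ x - L₃ y‖ * ‖-b₁‖ * ‖-b₁‖ * ‖-b₁‖ ≤ (K₄ * s₀) * m₁ * m₁ * m₁ := by gcongr
        _ = K₄ * s₀ * m₁ ^ 3 := by ring
    exact (abs_sub_le _ _ _).trans (add_le_add e₁ e₂)
  -- group 2: the bilinear term `(c₂, c₁)`
  have g2 : |L₂ x (a₂ - b₂) (a₁ - b₁) - L₂ y (-b₂) (-b₁)| ≤ K₂ * (s₂ * s₁ + s₂ * m₁ + m₂ * s₁) + K₃ * s₀ * m₂ * m₁ := by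
    have e₁ : |L₂ x (a₂ - b₂) (a₁ - b₁) - L₂ x (-b₂) (-b₁)| ≤ K₂ * (s₂ * s₁ + s₂ * m₁ + m₂ * s₁) := by
      rw [sub_eq_add_neg a₂ b₂, sub_eq_add_neg a₁ b₁]
      refine (abs_bilin_add_add_sub_le (L₂ x) a₂ (-b₂) a₁ (-b₁)).trans ?_
      have : ‖a₂‖ * ‖a₁‖ + ‖a₂‖ * ‖-b₁‖ + ‖-b₂‖ * ‖a₁‖ ≤ s₂ * s₁ + s₂ * m₁ + m₂ * s₁ := by gcongr
      exact mul_le_mul hL₂x this (by positivity) hK₂0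
    have e₂ : |L₂ x (-b₂) (-b₁) - L₂ y (-b₂) (-b₁)| ≤ K₃ * s₀ * m₂ * m₁ := by
      rw [show L₂ x (-b₂) (-b₁) - L₂ y (-b₂) (-b₁) = (L₂ x - L₂ y) (-b₂) (-b₁) from rfl, ← Real.norm_eq_abs]
      refine ((L₂ x - L₂ y).le_opNorm₂ _ _).trans ?_
      have hP : ‖L₂ x - L₂ y‖ ≤ K₃ * s₀ := hLip₂.trans (mul_le_mul_of_nonneg_left hs₀ hK₃0)
      have hP0 : 0 ≤ K₃ * s₀ := mul_nonneg hK₃0 hs00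
      calc ‖L₂ x - L₂ y‖ * ‖-b₂‖ * ‖-b₁‖ ≤ (K₃ * s₀) * m₂ * m₁ := by gcongr
        _ = K₃ * s₀ * m₂ * m₁ := by ring
    exact (abs_sub_le _ _ _).trans (add_le_add e₁ e₂)
  -- group 3: the bilinear term `(c₁, c₂)` (it occurs twice)
  have g3 : |L₂ x (a₁ - b₁) (a₂ - b₂) - L₂ y (-b₁) (-b₂)| ≤ K₂ * (s₁ * s₂ + s₁ * m₂ + m₁ * s₂) + K₃ * s₀ * m₁ * m₂ := by
    have e₁ : |L₂ x (a₁ - b₁) (a₂ - b₂) - L₂ x (-b₁) (-b₂)| ≤ K₂ * (s₁ * s₂ + s₁ * m₂ + m₁ * s₂) := by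
      rw [sub_eq_add_neg a₂ b₂, sub_eq_add_neg a₁ b₁]
      refine (abs_bilin_add_add_sub_le (L₂ x) a₁ (-b₁) a₂ (-b₂)).trans ?_
      have : ‖a₁‖ * ‖a₂‖ + ‖a₁‖ * ‖-b₂‖ + ‖-b₁‖ * ‖a₂‖ ≤ s₁ * s₂ + s₁ * m₂ + m₁ * s₂ := by gcongr
      exact mul_le_mul hL₂x this (by positivity) hK₂0
    have e₂ : |L₂ x (-b₁) (-b₂) - L₂ y (-b₁) (-b₂)| ≤ K₃ * s₀ * m₁ * m₂ := by
      rw [show L₂ x (-b₁) (-b₂) - L₂ y (-b₁) (-b₂) = (L₂ x - L₂ y) (-b₁) (-b₂) from rfl, ← Real.norm_eq_abs]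
      refine ((L₂ x - L₂ y).le_opNorm₂ _ _).trans ?_
      have hP : ‖L₂ x - L₂ y‖ ≤ K₃ * s₀ := hLip₂.trans (mul_le_mul_of_nonneg_left hs₀ hK₃0)
      have hP0 : 0 ≤ K₃ * s₀ := mul_nonneg hK₃0 hs00
      calc ‖L₂ x - L₂ y‖ * ‖-b₁‖ * ‖-b₂‖ ≤ (K₃ * s₀) * m₁ * m₂ := by gcongr
        _ = K₃ * s₀ * m₁ * m₂ := by ring
    exact (abs_sub_le _ _ _).trans (add_le_add e₁ e₂)
  -- group 4: the linear term
  have g4 : |fderiv ℝ f x (a₃ - b₃) - fderiv ℝ f y (-b₃)| ≤ K₁ * s₃ + K₂ * s₀ * m₃ := by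
    have e₁ : |fderiv ℝ f x (a₃ - b₃) - fderiv ℝ f x (-b₃)| ≤ K₁ * s₃ := by
      rw [← map_sub, show a₃ - b₃ - -b₃ = a₃ by abel, ← Real.norm_eq_abs]
      refine ((fderiv ℝ f x).le_opNorm a₃).trans ?_
      gcongr
      · exact hK₁ x
    have e₂ : |fderiv ℝ f x (-b₃) - fderiv ℝ f y (-b₃)| ≤ K₂ * s₀ * m₃ := by
      rw [show fderiv ℝ f x (-b₃) - fderiv ℝ f y (-b₃) = (fderiv ℝ f x - fderiv ℝ f y) (-b₃) from rfl, ← Real.norm_eq_abs]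
      refine ((fderiv ℝ f x - fderiv ℝ f y).le_opNorm _).trans ?_
      have hQ : ‖fderiv ℝ f x - fderiv ℝ f y‖ ≤ K₂ * s₀ := hLip₁.trans (mul_le_mul_of_nonneg_left hs₀ hK₂0)
      have hQ0 : 0 ≤ K₂ * s₀ := mul_nonneg hK₂0 hs00
      calc ‖fderiv ℝ f x - fderiv ℝ f y‖ * ‖-b₃‖ ≤ (K₂ * s₀) * m₃ := by gcongr
        _ = K₂ * s₀ * m₃ := by ring
    exact (abs_sub_le _ _ _).trans (add_le_add e₁ e₂)
  -- sum up
  have tri : ∀ p q u v : ℝ, |p + q + 2 * u + v| ≤ |p| + |q| + 2 * |u| + |v| := fun p q u v => by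
    have h₁ := abs_add_three p q (2 * u)
    have h₂ := abs_add_le (p + q + 2 * u) v
    have h₃ : |2 * u| = 2 * |u| := by rw [abs_mul, abs_two]
    linarith
  refine (tri _ _ _ _).trans ?_
  linarith [g1, g2, g3, g4]

end Abstract

/-! ## §2 The instantiations at the co-moving pp loop (near Cooper) and ph loop (near forward) -/

section Sizes

variable {K : TrigPolyC4v} {A : ℝ} (hA : ∀ p : Momentum, ∀ j ≤ 2, ‖iteratedFDeriv ℝ j (frameShift K) p‖ ≤ A) (hA20 : A ≤ 1 / 20)
  (hd : klCurveD ≤ (bandBounds (show (-4 : ℝ) < -1.1 by norm_num) (show (-1.1 : ℝ) ≤ -0.1 by norm_num)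
    (show (-0.1 : ℝ) < 0 by norm_num)).Dtmin - 2 * A)
  {μ r : ℝ} (hr : 0 < r) (hlo : (-1.1 : ℝ) < μ - r - A) (hhi : μ + r + A < -0.1)
  {A₃ A₄ : ℝ} (hA₃ : ∀ p : Momentum, ‖iteratedFDeriv ℝ 3 (frameShift K) p‖ ≤ A₃)
  (hA₄ : ∀ p : Momentum, ‖iteratedFDeriv ℝ 4 (frameShift K) p‖ ≤ A₄)
  {K₁ K₂ K₃ K₄ : ℝ} (hK₁ : ∀ p : Momentum, ‖fderiv ℝ (frameLevel μ K) p‖ ≤ K₁) (hK₂ : ∀ p : Momentum, ‖iteratedFDeriv ℝ 2 (frameLevel μ K) p‖ ≤ K₂)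
  (hK₃ : ∀ p : Momentum, ‖iteratedFDeriv ℝ 3 (frameLevel μ K) p‖ ≤ K₃) (hK₄ : ∀ p : Momentum, ‖iteratedFDeriv ℝ 4 (frameLevel μ K) p‖ ≤ K₄)
include hA hA20 hd hr hlo hhi hA₃ hA₄ hK₁ hK₂ hK₃ hK₄

omit hr hK₁ hK₂ hK₃ hK₄ in
/-- The single-frame angular table along `t ↦ Φ(e, α+t)` at `t = 0`: `‖∂_t^j Φ(e,α+·)(0)‖ ≤ msD A₃ A₄ j` (`1 ≤ j ≤ 4`). -/
theorem norm_iteratedDeriv_levelPoint_shift_le {e : ℝ} (he : |e| < r) (α : ℝ) {j : ℕ} (hj1 : 1 ≤ j) (hj4 : j ≤ 4) :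
    ‖iteratedDeriv j (fun t : ℝ => levelPoint μ K e (α + t)) 0‖ ≤ msD A₃ A₄ j := by
  rw [iteratedDeriv_comp_const_add j (levelPoint μ K e) α]
  show ‖iteratedDeriv j (levelPoint μ K e) (α + 0)‖ ≤ _
  rw [add_zero]
  exact norm_iteratedDeriv_levelPoint_le hA hA20 hd hlo hhi hA₃ hA₄ he hj1 hj4 α

/-- **ORDER 3 — THE ANISOTROPY DEFECT NEAR COOPER, third t-derivative**: for every loop level `|e| < r`, loop angle `α`, and pp path sizes
`‖S(0)‖ ≤ s₀`, `‖S′(0)‖ ≤ s₁`, `‖S″(0)‖ ≤ s₂`, `‖S‴(0)‖ ≤ s₃` (`S = pairSumPath μ K ρ ϑ θ`; each `s_j = O(|ρ| + |ϑ − π|)` by `norm_pairSumPath_zero_le`,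
`norm_deriv_pairSumPath_le_rigid`, `norm_iteratedDeriv_pairSumPath_le_rigid` with `norm_iteratedDeriv_two/three_levelPoint_sub_le`),
`|∂_t³|₀ e_K(S(t) − Φ(e, α+t))| ≤ K₃(s₁³ + 3s₁²D₁ + 3s₁D₁²) + 3K₂(s₁s₂ + s₂D₁ + s₁D₂) + K₁s₃ + K₄s₀D₁³ + 3K₃s₀D₁D₂ + K₂s₀D₃`, `D_j = msD A₃ A₄ j`. -/
theorem abs_iteratedDeriv_three_partnerBand_pp_le {ρ : ℝ} (hρ : |ρ| < r) {e : ℝ} (he : |e| < r) (ϑ θ α : ℝ) {s₀ s₁ s₂ s₃ : ℝ}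
    (hs₀ : ‖pairSumPath μ K ρ ϑ θ 0‖ ≤ s₀) (hs₁ : ‖iteratedDeriv 1 (pairSumPath μ K ρ ϑ θ) 0‖ ≤ s₁) (hs₂ : ‖iteratedDeriv 2 (pairSumPath μ K ρ ϑ θ) 0‖ ≤ s₂)
    (hs₃ : ‖iteratedDeriv 3 (pairSumPath μ K ρ ϑ θ) 0‖ ≤ s₃) :
    |iteratedDeriv 3 (fun t : ℝ => frameLevel μ K (pairSumPath μ K ρ ϑ θ t - levelPoint μ K e (α + t))) 0| ≤
      K₃ * (s₁ ^ 3 + 3 * s₁ ^ 2 * msD A₃ A₄ 1 + 3 * s₁ * msD A₃ A₄ 1 ^ 2) + 3 * K₂ * (s₁ * s₂ + s₂ * msD A₃ A₄ 1 + s₁ * msD A₃ A₄ 2) + K₁ * s₃ +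
        K₄ * s₀ * msD A₃ A₄ 1 ^ 3 + 3 * K₃ * s₀ * msD A₃ A₄ 1 * msD A₃ A₄ 2 + K₂ * s₀ * msD A₃ A₄ 3 := by
  set B₀ := bandBounds (show (-4 : ℝ) < -1.1 by norm_num) (show (-1.1 : ℝ) ≤ -0.1 by norm_num) (show (-0.1 : ℝ) < 0 by norm_num) with hB₀
  have hADt : 2 * A < B₀.Dtmin := by have := klCurveD_pos; linarith
  have hS : ContDiff ℝ 4 (pairSumPath μ K ρ ϑ θ) := contDiff_pairSumPath B₀ hA hADt hr hlo hhi hρ ϑ θ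
  have hγ : ContDiff ℝ 4 (fun t : ℝ => levelPoint μ K e (α + t)) := (contDiff_levelPoint_angle B₀ hA hADt hlo hhi he).comp (contDiff_const.add contDiff_id)
  have href : ∀ t : ℝ, frameLevel μ K (-levelPoint μ K e (α + t)) = e := fun t => frameLevel_neg_levelPoint_tube hA hlo hhi he (α + t)
  exact abs_iteratedDeriv_three_comp_sub_le (EngineV8.contDiff_frameLevel μ K) hK₁ hK₂ hK₃ hK₄ hS hγ href hs₀ hs₁ hs₂ hs₃
    (norm_iteratedDeriv_levelPoint_shift_le hA hA20 hd hlo hhi hA₃ hA₄ he α le_rfl (by norm_num))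
    (norm_iteratedDeriv_levelPoint_shift_le hA hA20 hd hlo hhi hA₃ hA₄ he α (by norm_num) (by norm_num))
    (norm_iteratedDeriv_levelPoint_shift_le hA hA20 hd hlo hhi hA₃ hA₄ he α (by norm_num) (by norm_num))

/-- **ORDER 3 — THE NESTING DEFECT NEAR FORWARD, third t-derivative**: for every loop level `|e| < r`, loop angle `α`, and ph path sizes `‖D(0)‖ ≤ s₀`,
`‖D′(0)‖ ≤ s₁`, `‖D″(0)‖ ≤ s₂`, `‖D‴(0)‖ ≤ s₃` (`D = pairDiffPath μ K ρ ϑ θ`; each `s_j = O(|ρ| + |ϑ|)` by `norm_pairDiffPath_zero_le`, `norm_deriv_pairDiffPath_le_rigid`,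
`norm_iteratedDeriv_pairDiffPath_le_rigid`), the same bound holds for `|∂_t³|₀ e_K(Φ(e, α+t) − D(t))|`. -/
theorem abs_iteratedDeriv_three_partnerBand_ph_le {ρ : ℝ} (hρ : |ρ| < r) {e : ℝ} (he : |e| < r) (ϑ θ α : ℝ) {s₀ s₁ s₂ s₃ : ℝ}
    (hs₀ : ‖pairDiffPath μ K ρ ϑ θ 0‖ ≤ s₀) (hs₁ : ‖iteratedDeriv 1 (pairDiffPath μ K ρ ϑ θ) 0‖ ≤ s₁)
    (hs₂ : ‖iteratedDeriv 2 (pairDiffPath μ K ρ ϑ θ) 0‖ ≤ s₂) (hs₃ : ‖iteratedDeriv 3 (pairDiffPath μ K ρ ϑ θ) 0‖ ≤ s₃) :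
    |iteratedDeriv 3 (fun t : ℝ => frameLevel μ K (levelPoint μ K e (α + t) - pairDiffPath μ K ρ ϑ θ t)) 0| ≤
      K₃ * (s₁ ^ 3 + 3 * s₁ ^ 2 * msD A₃ A₄ 1 + 3 * s₁ * msD A₃ A₄ 1 ^ 2) + 3 * K₂ * (s₁ * s₂ + s₂ * msD A₃ A₄ 1 + s₁ * msD A₃ A₄ 2) + K₁ * s₃ +
        K₄ * s₀ * msD A₃ A₄ 1 ^ 3 + 3 * K₃ * s₀ * msD A₃ A₄ 1 * msD A₃ A₄ 2 + K₂ * s₀ * msD A₃ A₄ 3 := by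
  set B₀ := bandBounds (show (-4 : ℝ) < -1.1 by norm_num) (show (-1.1 : ℝ) ≤ -0.1 by norm_num) (show (-0.1 : ℝ) < 0 by norm_num) with hB₀
  have hADt : 2 * A < B₀.Dtmin := by have := klCurveD_pos; linarith
  have hfun : (fun t : ℝ => frameLevel μ K (levelPoint μ K e (α + t) - pairDiffPath μ K ρ ϑ θ t)) =
      fun t : ℝ => frameLevel μ K ((fun s : ℝ => -pairDiffPath μ K ρ ϑ θ s) t - (fun s : ℝ => -levelPoint μ K e (α + s)) t) := by
    funext t; simp only [sub_neg_eq_add, neg_add_eq_sub]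
  rw [hfun]
  have hS : ContDiff ℝ 4 (fun s : ℝ => -pairDiffPath μ K ρ ϑ θ s) := (contDiff_pairDiffPath B₀ hA hADt hr hlo hhi hρ ϑ θ).neg
  have hγ : ContDiff ℝ 4 (fun s : ℝ => -levelPoint μ K e (α + s)) :=
    ((contDiff_levelPoint_angle B₀ hA hADt hlo hhi he).comp (contDiff_const.add contDiff_id)).neg
  have href : ∀ t : ℝ, frameLevel μ K (-(fun s : ℝ => -levelPoint μ K e (α + s)) t) = e := fun t => by
    simp only [neg_neg]; exact frameLevel_levelPoint_tube B₀ hA hlo hhi he (α + t)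
  have hn0 : ‖(fun s : ℝ => -pairDiffPath μ K ρ ϑ θ s) 0‖ ≤ s₀ := by simp only [norm_neg]; exact hs₀
  have hnS : ∀ j : ℕ, iteratedDeriv j (fun s : ℝ => -pairDiffPath μ K ρ ϑ θ s) 0 = -iteratedDeriv j (pairDiffPath μ K ρ ϑ θ) 0 := fun j =>
    iteratedDeriv_fun_neg j _ 0
  have hnγ : ∀ j : ℕ, iteratedDeriv j (fun s : ℝ => -levelPoint μ K e (α + s)) 0 = -iteratedDeriv j (fun s : ℝ => levelPoint μ K e (α + s)) 0 := fun j =>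
    iteratedDeriv_fun_neg j (fun s : ℝ => levelPoint μ K e (α + s)) 0
  have hn1 : ‖iteratedDeriv 1 (fun s : ℝ => -pairDiffPath μ K ρ ϑ θ s) 0‖ ≤ s₁ := by rw [hnS, norm_neg]; exact hs₁
  have hn2 : ‖iteratedDeriv 2 (fun s : ℝ => -pairDiffPath μ K ρ ϑ θ s) 0‖ ≤ s₂ := by rw [hnS, norm_neg]; exact hs₂
  have hn3 : ‖iteratedDeriv 3 (fun s : ℝ => -pairDiffPath μ K ρ ϑ θ s) 0‖ ≤ s₃ := by rw [hnS, norm_neg]; exact hs₃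
  have hm1 : ‖iteratedDeriv 1 (fun s : ℝ => -levelPoint μ K e (α + s)) 0‖ ≤ msD A₃ A₄ 1 := by
    rw [hnγ, norm_neg]; exact norm_iteratedDeriv_levelPoint_shift_le hA hA20 hd hlo hhi hA₃ hA₄ he α le_rfl (by norm_num)
  have hm2 : ‖iteratedDeriv 2 (fun s : ℝ => -levelPoint μ K e (α + s)) 0‖ ≤ msD A₃ A₄ 2 := by
    rw [hnγ, norm_neg]; exact norm_iteratedDeriv_levelPoint_shift_le hA hA20 hd hlo hhi hA₃ hA₄ he α (by norm_num) (by norm_num)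
  have hm3 : ‖iteratedDeriv 3 (fun s : ℝ => -levelPoint μ K e (α + s)) 0‖ ≤ msD A₃ A₄ 3 := by
    rw [hnγ, norm_neg]; exact norm_iteratedDeriv_levelPoint_shift_le hA hA20 hd hlo hhi hA₃ hA₄ he α (by norm_num) (by norm_num)
  exact abs_iteratedDeriv_three_comp_sub_le (EngineV8.contDiff_frameLevel μ K) hK₁ hK₂ hK₃ hK₄ hS hγ href hn0 hn1 hn2 hn3 hm1 hm2 hm3

end Sizes

end Summit.HubbardSuperconductivity.HubbardSuperconductivity.Theorems.C4a

end
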